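import Summits.CriticalPhenomena.PercolationContinuityZ3.Theorems.Transplant.KNCellsBoxProdZ2ConcG
import Summits.CriticalPhenomena.PercolationContinuityZ3.Theorems.Transplant.KNCells2SepQ
import Summits.CriticalPhenomena.PercolationContinuityZ3.Theorems.Transplant.PlanarCellsSepQ
import HarnessLib

/-!
# `QSepGeom` for the concentric `X □ ℤ²` cells: the cube `Q_a(x)` is G-SEPARATED from the cells of the other macro-vertices and from all
# stub zones, for ALL anchors (the hypothesis `hQ` of p2-g2's `Valid₂.sep_habitat` / `mem_of_adj_fresh`, KNCells2SepQ p221141 — the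
# entrance analysis of the corridor chain, design (D), §11 v2)

builds on p205010 (kernel theorem, internal audit signed; external expert review pending) — nothing in this file uses p205010.
Lane `prim-bschramm`, seat `prim-bschramm-p3` (order I2 of V56; residue `hout_of_valid`, instance half); helper file
(`--supports stmt-CriticalPhenomena-4575 --as helper`).

The two fields are fibre-blind: cells and zones are products `B_X(w₀, ·) × planar`, cubes likewise, so the planar separations
`PCells.Cell_sep_Q` (`cen u ± 10r` vs `cen x ± 5r`, `u ≠ x`) and `PCells.Zone_sep_Q` (the zone stops `10s` rows short of the next cube)
lift by `sep_prodR` whatever the radii.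
* **`qSepGeomCG`** — `KNCells.QSepGeom (X □ zdGraph 2) (cellGeomCG X C w₀ Λ)` for EVERY schedule `Λ : ConcRadiiG` (no `WF` needed).
[cite: KozmaNitzan2024, §4 pp. 26, 31 ((29), (31)) — the ℤ^d model]
-/

noncomputable section

open scoped Classical

namespace Summit.CriticalPhenomena.PercolationContinuityZ3.Theorems

namespace Transplant

namespace BoxProdZ2

open Literature.Probability.Percolation Literature.Probability.LatticeModels SimpleGraph GadgetSystem Contour KNCells

variable {W : Type} [DecidableEq W] (X : SimpleGraph W) [X.LocallyFinite] (C : PCells) (w₀ : W) (Λ : ConcRadiiG)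

/-- **`QSepGeom` for the concentric cells** (all anchors, any schedule). [cite: KozmaNitzan2024, §4 p. 31 ((31))] -/
theorem qSepGeomCG : QSepGeom (X □ zdGraph 2) (cellGeomCG X C w₀ Λ) where
  Cell_sep_Q _ _ _ _ hux := sep_prodR X (C.Cell_sep_Q hux)
  Zone_sep_Q _ _ u δ x _ := sep_prodR X (C.Zone_sep_Q u δ x)

end BoxProdZ2

end Transplant

end Summit.CriticalPhenomena.PercolationContinuityZ3.Theorems

end
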